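import Mathlib
import HarnessLib
import HarnessLib.Audit
import Summits.QuantumFields.Statement
import Summits.QuantumFields.YangMills.Theorems.SoloInformedU1HelicityTorus
import Literature.MathematicalPhysics.QuantumFieldTheory.AbelianTorusCochains
import HarnessLib.Audit.Status.Attr

/-!
Route: WilsonVillainDualStiffness

# Route WilsonVillainDualStiffness — Wilson U(1)₄ torus helicity gap (node U1HelicityGapTorusD4) via
Hartman–Watson annealed-Villain duality + lattice-Gaussian monotonicity ⇒ diluted-Villain dual
stiffness (LINE; no summit proved)

X («it suffices to show X»), a LINE onto the EXISTING node
`Summit.QuantumFields.YangMills.Theorems.U1HelicityGapTorusD4` (@[conjecture],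
SoloInformedU1HelicityTorus.lean:108: for β > β₁ the
finite-TORUS Wilson U(1)₄ theory has a helicity gap, β·torusBoxVar β M N ≤ (torusMeanPlaq β M −
δ)·#B_N eventually in N and then M), whose tree
corollaries `u1HelicityGapD4_of_torus` and `abelianMasslessPhaseD4_of_u1HelicityGapD4` give the
Wilson-action masslessness
`Literature.Barriers.QuantumFields.AbelianMasslessPhaseD4` (open in print for Wilson's action:
FrohlichSpencerCMP1982 p.433 fn. 3). X = X1 ∧ X2 with
X1 = `DilutedVillainDualStiffness` (deciding, rank 2): the ℤ-valued Gaussian («Villain-dual»)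
co-closed 2-current on the 4-torus with weight
exp(−Σn²/2Λ), diluted by deleting an independent Bernoulli(ρ) set of plaquettes, has flux variance
through the box B_N of order Λ·#B_N (annealed in
the dilution) for Λ large and ρ small; X2 = `WilsonDilutedVillainComparison` (rank 3): the Wilson
torus helicity deficit
β·⟨cos θ_p⟩·#B_N − β²·Var(Σ_B sin θ) dominates c·(that diluted dual variance at Λ = c₀β, some ρ ≤
ρ₀) uniformly in the volume. No idea card is
realised (ideas: []); no summit and no ladder rung is proved by this line — it bears on the BARRIER
ledger (LADDER-YM §1c, AbelianMasslessPhaseD4).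
Lean: `Summit.QuantumFields.YangMills.Theses.WilsonVillainDualStiffness.DilutedVillainDualStiffness
∧ Summit.QuantumFields.YangMills.Theses.WilsonVillainDualStiffness.WilsonDilutedVillainComparison`

## Assembly
Pure logic and real arithmetic: given β > β₁ := max(β₀(ρ₀), Λ₁/c₀, 1), the comparison crux supplies
ρ ≤ ρ₀ and the one-sided bound for all
2N+2 ≤ M; the stiffness crux at Λ = c₀β > Λ₁ and that ρ supplies δ, N₀, M₀; chaining gives
β·(β·torusBoxVar) ≤ β·((torusMeanPlaq − c·δ·c₀)·#B_N)
for N ≥ N₀, M ≥ max(M₀, 2N+2), i.e. the node with δ' = c·δ·c₀ (kernel-checked in Sketch.lean,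
`closes`, rc 0, no sorry).

Rationale: WHY THIS LINE. Mechanism (positivity/convexity card): (i) the exact helicity identity — for any
torus plaquette weight w with Fourier coefficients ŵ ≥ 0,
Σ_p h_p²⟨−(log w)″(θ_p)⟩ − ⟨(Σ_p h_p (log w)′(θ_p))²⟩ = E_dual[⟨n,h⟩²], the variance of the dual
co-closed integer 2-current against the test
2-form h (Fourier duality on the torus; for Wilson w = e^{β cos} the left side is exactly
β·torusMeanPlaq·#B − β²·torusBoxVar, the lattice-gauge
helicity modulus of Vettorazzo–de Forcrand, arXiv:hep-lat/0311007 §4, there only measured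
numerically); (ii) the Hartman–Watson theorem
I_n(β) = ∫₀^∞ e^{−n²t/2} Θ(β,t) dt (arXiv:1904.00595 eq. (1.3); Hartman–Watson 1974, Yor 1980) = the
Wilson weight is an ANNEALED VILLAIN weight
with random coupling 1/t (the 2-D XY version is Lemma 9.6 of Aizenman–Harel–Peled–Shapiro
arXiv:2110.09498, after Raoufi), so the Wilson dual current
is a mixture of inhomogeneous ℤ-Gaussian currents; (iii) Regev–Stephens-Davidowitz monotonicity of
second moments of lattice Gaussians in the quadratic
form and in the sublattice (arXiv:2110.09498 Prop. 2.3/(sub_latt_monotonicity), [RegDav17]) lets one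
push every cold coupling down to c₀β and delete
every hot plaquette, at the price of a hot-set whose conditional density is O(1/β) by Ginibre's
inequality (tree: `ginibreExpect_reChar_mono`) — a
one-sided comparison Wilson ≥ diluted Villain(c₀β); (iv) the remaining statement is inside the
Gaussian-plus-integer (Villain/Coulomb-gas)
technology of FrohlichSpencerCMP1982 §2, Guth1980, GarbanSepulveda2023 (arXiv:2107.04021), with
dilute annealed plaquette deletions added. Imported
area: exponential functionals of Brownian motion / Hartman–Watson laws (probability) and
lattice-Gaussian (discrete Gaussian / lattice cryptography)
moment monotonicity, neither used on 4-D gauge theory before (searches below). What it does that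
listed routes do not: route
U1DipoleHelicity (ym-idea-2) attacks the weaker limit-state node U1HelicityGapD4 through a
Wilson-specific multiscale DIPOLE LAW and records that «a
one-sided variance bound has no mechanism of its own for plaquette actions»; this line supplies
exactly such a one-sided mechanism (character
positivity + annealing + convex-order monotonicity), never expands the Wilson action, and targets
the stronger torus node. Negatives index
(stmt 15826, 18944, 14958, 9665, 9494, 9599, 9603): none concerns U(1) duality or helicity; nothing
reused.

RANKED CRUXES. #2 DilutedVillainDualStiffness (crux) — Annealed Bernoulli(ρ)-diluted Villain-dual
current stiffness on the 4-torus (ℤ/(M+1))⁴: there are ρ₀ > 0 and Λ₁ such that for every Λ > Λ₁ and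
ρ ∈ [0, ρ₀] there is δ > 0 with, for N ≥ N₀ and then M ≥ M₀(N), Σ_H ρ^|H| (1−ρ)^(#P−|H|) ·
Var_{Λ,H}(N_B) ≥ δ·Λ·#B_N, where Var_{Λ,H} is the second moment of the box flux N_B(n) = Σ_{x∈B_N}
n_(x;0,1) under the probability ∝ exp(−Σ_p n_p²/2Λ) on integer plaquette fields n that are co-closed
(orthogonal to every td₁ of an edge indicator) and vanish on H. [difficulty: XL] (why it might fail:
deleted plaquettes free the monopole constraint on their 3-cells (local magnetic defects of density
ρ, activity not e^(−cΛ)); if the Coulomb phase of the dual needed ρ ≤ ρ₀(Λ) → 0, the comparison crux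
(ρ = O(1/β), Λ = c₀β) would not feed it.) [FrohlichSpencerCMP1982, Guth1980, arXiv:2107.04021,
arXiv:2110.09498]
#3 WilsonDilutedVillainComparison (crux) — One-sided annealed-Villain comparison for the Wilson
torus theory: there are c, c₀ > 0 such that for every ρ₀ > 0, for β > β₀(ρ₀) some ρ ∈ [0, ρ₀]
satisfies, for all N, M with 2N+2 ≤ M, β·torusMeanPlaq β M·#B_N − β²·torusBoxVar β M N ≥ c·Σ_H
ρ^|H|(1−ρ)^(#P−|H|)·Var_{c₀β,H}(N_B) (same diluted dual variance as in the rank-2 crux, at Λ = c₀β).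
Route of proof: helicity identity (left side = E_Wilson-dual[N_B²]) → Hartman–Watson mixture → RSD
monotonicity in the couplings and in the sublattice → hot-set (coupling < c₀β) conditional density ≤
ρ(β) = O(1/β) by Ginibre → stochastic domination by Bernoulli(ρ). [difficulty: L] (why it might
fail: the hot-set bound needs the Hartman–Watson posterior coupling given plaquette angle |θ| ≤ θ₁
to exceed c₀β (saddle ≈ β·sin θ/θ) with volume-uniform conditional control; near θ = π it
degenerates, so c₀ is small and Ginibre/Markov gives only ρ = O(1/β).) [arXiv:2110.09498,
arXiv:1904.00595, arXiv:hep-lat/0311007, MontvayMunster1994]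

TWO-LAYER PLAN. Foreseen split of WilsonDilutedVillainComparison (once staffed): C ⇐ S1 → S2 → S3 →
C with S1 = HelicityDualIdentity (β·torusMeanPlaq·#B − β²·torusBoxVar
= E_Wilson-dual[N_B²], Bessel weights ∏ I_(n_p)(β) on co-closed torus currents; provable now from
the tree's torus character expansion, cf.
`zdU1DualPartition` for free b.c.), S2 = HotSetDominatedComparison (E_Wilson-dual[N_B²] ≥ Σ_H
π_β(H)·Var_{c₀β,H}(N_B) for a hot-set law π_β with
one-point conditional densities ≤ ρ(β) → 0: Hartman–Watson + RSD + Ginibre), S3 =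
BernoulliDomination (antitone H ↦ Var_{Λ,H} and conditional densities
≤ ρ ⇒ Σ_H π(H)V(H) ≥ Σ_H Bern_ρ(H)V(H); finite probability). Foreseen split of
DilutedVillainDualStiffness: undiluted torus stiffness (ρ = 0, FS82 §2.11 /
GS23 renormalisation on the torus) → stability under Bernoulli(ρ) deletions (dilute local defects in
the 4-D Coulomb gas). The δ = 0 rung
WilsonTorusGaussianDomination (β·torusBoxVar β M N ≤ torusMeanPlaq β M·#B_N for 2N+2 ≤ M, all β > 0:
= E_dual[N_B²] ≥ 0) is stub S0 of the comparison
skeleton (typed in Sketch.lean, not an item).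

KILL CRITERIA. Refutation of DilutedVillainDualStiffness at ρ = 0 (undiluted Villain torus dual has
flux variance o(Λ·#B) at large Λ) kills the line and the node's
Villain analogue with it (close refuted:DilutedVillainDualStiffness). A proof that the
Hartman–Watson posterior coupling given |θ_p| ≤ π/2 is NOT
bounded below by c₀β uniformly (c₀ > 0) kills WilsonDilutedVillainComparison as typed → pivot:
comparison with θ-dependent thresholds (S2 with a
soft cut). If route U1DipoleHelicity proves U1HelicityGapD4 first, this line is still not moot
(torus node is stronger) but loses its barrier value →
close superseded.

NOT DECOMPOSED YET. The Hartman–Watson large-deviation estimate (posterior coupling ≥ c₀β away from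
θ = π; asymptotics of Θ(β,t) for β → ∞, Gerhold 2011 / arXiv:1904.00595),
the torus version of the Bessel character expansion (tree has ℤ^d free b.c.:
`zdExpect_u1_wilsonLoop_eq_dual`), the RSD lemma for the co-closed
current lattice (a sublattice of ℤ^P: [RegDav17] applies verbatim), and all constants (c₀ ≈ 10⁻²,
ρ(β) = O(1/β), δ ≈ 1/2·(1 − O(ρ) − O(e^(−cΛ)))) are
layer-2 children; none is filed now.

CHEAPEST FALSIFIER. (a) Lookup/run: is ν ↦ I_ν(β)/I_0(β) a Laplace transform in ν²/2 of a positive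
measure? YES — Hartman–Watson (arXiv:1904.00595 eq. (1.3)), so the
annealing step cannot fail. (b) The one cheap computation that could kill the comparison crux as
TYPED: evaluate the Hartman–Watson posterior mode
λ*(θ)/β given plaquette angle θ (saddle of t ↦ e^(−θ²/2t)Θ(β,t)); prediction λ*(θ) ≈ β·sin θ/θ,
hence ≥ (2/π)β for |θ| ≤ π/2 ≫ c₀β; a numerical
Θ(β,t) (Gerhold's expansion) at β ∈ {5, 20, 50} decides it in minutes (not run: kit not used this
session). (c) For the deciding crux: exact
enumeration of the ρ = 0 dual variance on the 2⁴ torus, |n_p| ≤ 2, Λ ∈ {2, 5} vs Λ·#B/2 (sanity of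
sign and scale only).

NUMBERS. Free-photon benchmark: at ρ = 0 and Λ → ∞ the dual flux variance per box plaquette →
Λ·‖P_coclosed h_B‖²/#B → Λ/2 (half of the plaquette modes are
co-closed in d = 4; dual of FreeDipoleBoxMeanHalf of route U1DipoleHelicity), so δ ≤ 1/2 in
DilutedVillainDualStiffness and the node's δ' = c·δ·c₀ is
≈ c₀/2 ≈ 5·10⁻³. Hot-set density from the Ginibre/Markov step: ρ(β) ≤ (1 − I₁(β)/I₀(β))/(1 − cos θ₁)
≈ 1/(2β(1 − cos θ₁)). Strong coupling check:
the node's deficit is a boundary term there (tree `SoloInformedU1HelicitySaturation`), consistent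
with dual currents being short loops (Var(N_B) ~ |∂B|).

DEFINITION REQUESTS. None filed at open: the diluted dual variance is inlined (identically) in both
crux statements over `Plaquette`, `Edge`, `LatticeForm.td₁/res`
(AbelianTorusCochains) and `box`; a named `dilutedVillainBoxFluxVar Λ ρ M N` under
Summits/QuantumFields/YangMills/Theorems would shorten both —
to be requested by the first prover if wanted.

Novelty: Searches (2026-08-28): lit search "Hartman-Watson Bessel" (6 local hits, all probability/finance:
arXiv:1904.00595, doi:10.1007/s11118-019-09806-7, arXiv:math/0311280); lit search --hybrid "helicity
modulus compact U(1) lattice gauge theory twisted boundary conditions flux" (8: Greensite 2011,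
Montvay–Münster 1994 — textbook flux/twist, no proof); lit search "Vettorazzo Forcrand helicity
modulus" (5: hep-lat/0311007, hep-lat/0311006, hep-lat/0409135, 0801.3722 — numerical order
parameter); lit search --hybrid "Regev Stephens-Davidowitz discrete Gaussian lattice monotonicity"
(0 relevant); lit vsearch "Wilson weight exp(beta cos) mixture of Villain weights random coupling
annealed" (0 relevant: Greensite p.19, Itzykson–Drouffe); lit galaxy search "helicity modulus"
--star pdf (8, condensed-matter/XY only); lit galaxy search "Hartman-Watson|annealed Villain|Villain
coupling is random" --star pdf (6, none on gauge theory); lit read arXiv:2110.09498 §§9–10 (annealed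
Gaussian interactions, 2-D XY only); tree: lean search torusBoxVar / circleHeatKernel /
zdU1DualPartition / ginibreExpect_reChar_mono.
Nearest prior art found: arXiv:2110.09498 (Aizenman–Harel–Peled–Shapiro 2021) Lemma 9.6 + §10 — XY
weight as annealed Villain (Raoufi) + RSD monotonicity, used for DEPINNING of 2-D height functions;
arXiv:hep-lat/0311007 (Vettorazzo–de Forcrand) — the gauge helicity modulus h(β) = V⁻¹⟨Σβ cos θ_P⟩ −
V⁻¹⟨(Σβ sin θ_P)²⟩ as a NUMERICAL order parameter of 4-D compact U(1); FrohlichSpencerCM  [refs: 10.1007/s11118-019-09806-7, 1904.00595, math/0311280, 2110.09498, hep-lat/0311007, doi:10.1007/s11118-019-09806-7, FrohlichSpencerCMP1982]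

Barriers (technique_class: correlation-inequalities, duality, convexity): - technique_class: correlation-inequalities, duality, convexity
- Literature.Barriers.QuantumFields.AbelianDeconfinementD4: outside its scope — the barrier blocks
group-blind / strong-coupling / correlation-inequality proofs of CONFINEMENT or a MASS GAP that
would apply verbatim to U(1)₄ at weak coupling; this line proves the OPPOSITE side for U(1)₄ itself
(the node implies the Wilson masslessness `AbelianMasslessPhaseD4` of
AbelianDeconfinementD4.lean:505 via tree theorems), i.e. it sharpens the barrier from Villain (tree:
villain_perimeter_law) to Wilson; FS82 p.433 fn. 3 (Wilson needs a different expansion) is bypassed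
by the Hartman–Watson annealing, not met head-on.
- Literature.Barriers.QuantumFields.NonabelianCoulombPhaseD5: does not quantify over this line — it
blocks dimension-blind devices (RP, convexity, correlation inequalities …) as proofs of an SU(2)₄
MASS GAP; here the same dimension-blind devices (Ginibre, Hartman–Watson mixture, RSD monotonicity)
are used to prove MASSLESSNESS of U(1)₄, and their d = 5 verbatim transfer (U(1)₅ Coulomb phase) is
true, so no contradiction arises; nothing here is offered as a non-abelian gap mechanism.
- Literature.Barriers.QuantumFields.ElitzurTheorem: outside — every quantity (plaquette cos/sin
sums, dual integer currents, flux variances) is gauge invariant; no local order parameter is used.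
- Negatives index: stmt-QuantumFields-9665 (diagonal mirror RP refuted) is not used — no reflection
across a diagonal; 15826/18944/14958/

History (route lifecycle, newest last):
- 2026-08-28T07:56:08Z · rev 1: restated DilutedVillainDualStiffness (stmt-QuantumFields-26247) — g6 sub-route LINE (critic idea-crit-4 price P1): crux 26247 restated to the exported-rate regime 0 ≤ ρ ≤ exp(−Λ) (was ρ ≤ ρ₀); the comparison crux will export ρ (planner-ym-idea-3-g6-0)
- 2026-08-28T07:57:34Z · rev 2: restated WilsonDilutedVillainComparison (stmt-QuantumFields-26248) — g6 sub-route LINE (critic P1): comparison crux restated to EXPORT the defect rate (∃ρ ≤ exp(−c₀β)) instead of ∀ρ₀∃β₀; matches the restated stiffness crux (ρ ≤ e (planner-ym-idea-3-g6-0)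
- 2026-08-28T07:58:49Z · rev 3: dropped Assembly — g6 sub-route LINE: the deciding theorem now PROVES the node from the two cruxes directly (closes h₁ h₂ : U1HelicityGapTorusD4, logic + real arithmetic, kernel-c (planner-ym-idea-3-g6-0)
- 2026-08-28T08:54:17Z · rev 5: informal re-worded for HartmanWatsonMixture (planner-ym-idea-3-g6-0)

sub-problem: YangMills · status: draft · opened planner-ym-idea-3-g5-0 2026-08-28T06:33:43Z · rev 5 · ledger route-QuantumFields-WilsonVillainDualStiffness
GENERATED by the gate from the ledger (D-0016/17). Provers cite these decls: `theorem foo : Summit.QuantumFields.YangMills.Theses.WilsonVillainDualStiffness.<Decl> := …` in Summits/QuantumFields/YangMills/Theorems/<Name>.lean.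
-/

namespace Summit.QuantumFields.YangMills.Theses.WilsonVillainDualStiffness

open scoped BigOperators Topology Manifold Classical MeasureTheory ProbabilityTheory Matrix InnerProductSpace ComplexConjugate ContinuousMap
open Filter Set Function TopologicalSpace MeasureTheory

attribute [summit_statement] _root_.YangMills

-- earlier DilutedVillainDualStiffness (stmt-QuantumFields-26247, replaced 2026-08-28T07:56:08Z -> stmt-QuantumFields-26794): retired by None — ∃ ρ₀ : ℝ, 0 < ρ₀ ∧ ∃ Λ₁ : ℝ, ∀ Λ : ℝ, Λ₁ < Λ → ∀ ρ : ℝ, 0 ≤ ρ → ρ ≤ ρ₀ → ∃ δ : ℝ, 0 < δ ∧ ∃ N₀ : ℕ, ∀ N : ℕ, N₀ ≤ N → ∃ M₀ : ℕ, ∀ M : ℕ, M₀ ≤ M → δ * Λ * ((Literature.Probability.LatticeModels.box 4 N).card : ℝ) ≤ (fun (Λ ρ : ℝ) (M N : ℕ) => ∑ H : Finset (Lit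
/-- item stmt-QuantumFields-26794 · crux · rank 2 · open · by planner
why it might fail: Guth/FS82 Coulomb phase of Villain U(1)₄ in dual form + annealed e^{−Λ}-rare deleted plaquettes: FS82's expansion is on ℤ⁴; torus winding sectors and rare large defect clusters need activities ~e^{−cΛ|cluster|}; if only e^{−Λ} per cluster, no convergence at fixed Λ.
sources: FrohlichSpencerCMP1982, Guth1980, arXiv:2107.04021, arXiv:2110.09498
[crux, rank 2, deciding; RESTATED g6 in the exported-rate regime (critic idea-crit-4 price P1)]
Dilute-defect annealed Villain-dual current stiffness on the 4-torus: there is Λ₁ such that for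
every Λ > Λ₁ and every defect density 0 ≤ ρ ≤ e^{−Λ} there are δ > 0, N₀ and, for each N ≥ N₀, an M₀
with Σ_H ρ^|H|(1−ρ)^(#P−|H|)·E_{Λ,H}[N_B²] ≥ δ·Λ·#B_N for all M ≥ M₀ — the ℤ-valued co-closed
plaquette field on (ℤ/(M+1))⁴ with weight exp(−Σ_p n_p²/(2Λ)), forced to vanish on an independent
Bernoulli(ρ) plaquette set H, has box-flux variance a fixed fraction of the massless value, annealed
over H. This is the Guth / Fröhlich–Spencer Coulomb phase of Villain U(1)₄ (β_Villain = Λ) in dual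
form, with exponentially rare annealed defects (a deleted dual plaquette = a plaquette removed from
the Villain action). Supersedes the g5 text (ρ ≤ ρ₀ constant): the comparison crux now EXPORTS ρ ≤
e^{−c₀β} = e^{−Λ}, so only the dilute regime is load-bearing. -/
@[route_item "route-QuantumFields-WilsonVillainDualStiffness", crux]
def DilutedVillainDualStiffness : Prop :=
  ∃ Λ₁ : ℝ, ∀ Λ : ℝ, Λ₁ < Λ → ∀ ρ : ℝ, 0 ≤ ρ → ρ ≤ Real.exp (-Λ) → ∃ δ : ℝ, 0 < δ ∧ ∃ N₀ : ℕ, ∀ N : ℕ, N₀ ≤ N → ∃ M₀ : ℕ, ∀ M : ℕ, M₀ ≤ M → δ * Λ * ((Literature.Probability.LatticeModels.box 4 N).card : ℝ) ≤ (fun (Λ ρ : ℝ) (M N : ℕ) => ∑ H : Finset (Literature.MathematicalPhysics.QuantumFieldTheory.Plaquette 4 (M + 1)), ρ ^ H.card * (1 - ρ) ^ (Fintype.card (Literature.MathematicalPhysics.QuantumFieldTheory.Plaquette 4 (M + 1)) - H.card) * ((∑' n : Literature.MathematicalPhysics.QuantumFieldTheory.Plaquette 4 (M + 1) → ℤ,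 (if (∀ p ∈ H, n p = 0) ∧ (∀ e : Literature.MathematicalPhysics.QuantumFieldTheory.Edge 4 (M + 1), ∑ p : Literature.MathematicalPhysics.QuantumFieldTheory.Plaquette 4 (M + 1), n p * Literature.MathematicalPhysics.QuantumFieldTheory.LatticeForm.res (Literature.MathematicalPhysics.QuantumFieldTheory.LatticeForm.td₁ (fun (y : Literature.MathematicalPhysics.QuantumFieldTheory.Site 4 (M + 1)) (k : Fin 4) => if y = e.1 ∧ k = e.2 then (1 : ℤ) else 0)) p = 0) then Real.exp (-(∑ p : Literature.MathematicalPhysics.QuantumFieldTheory.Plaquette 4 (M + 1), ((n p : ℝ) ^ 2)) / (2 * Λ)) else 0) * (∑ x ∈ Literature.Probability.LatticeModels.box 4 N, (n ((fun i => ((x i : ℤ) : ZMod (M + 1))), ⟨((0 : Fin 4), (1 : Fin 4)), by decide⟩) : ℝ)) ^ 2) / (∑' n : Literature.MathematicalPhysics.QuantumFieldTheory.Plaquette 4 (M + 1) → ℤ, (if (∀ p ∈ H, n p = 0) ∧ (∀ e : Literature.MathematicalPhysics.QuantumFieldTheory.Edge 4 (M + 1), ∑ p : Literature.MathematicalPhysics.QuantumFieldTheory.Plaquette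 4 (M + 1), n p * Literature.MathematicalPhysics.QuantumFieldTheory.LatticeForm.res (Literature.MathematicalPhysics.QuantumFieldTheory.LatticeForm.td₁ (fun (y : Literature.MathematicalPhysics.QuantumFieldTheory.Site 4 (M + 1)) (k : Fin 4) => if y = e.1 ∧ k = e.2 then (1 : ℤ) else 0)) p = 0) then Real.exp (-(∑ p : Literature.MathematicalPhysics.QuantumFieldTheory.Plaquette 4 (M + 1), ((n p : ℝ) ^ 2)) / (2 * Λ)) else 0)))) Λ ρ M N

-- earlier WilsonDilutedVillainComparison (stmt-QuantumFields-26248, replaced 2026-08-28T07:57:34Z -> stmt-QuantumFields-26795): retired by None — ∃ c : ℝ, 0 < c ∧ ∃ c₀ : ℝ, 0 < c₀ ∧ ∀ ρ₀ : ℝ, 0 < ρ₀ → ∃ β₀ : ℝ, ∀ β : ℝ, β₀ < β → ∃ ρ : ℝ, 0 ≤ ρ ∧ ρ ≤ ρ₀ ∧ ∀ N M : ℕ, 2 * N + 2 ≤ M → c * ((fun (Λ ρ : ℝ) (M N : ℕ) => ∑ H : Finset (Literature.MathematicalPhysics.QuantumFieldTheory.Plaquette 4 (M + 1)), ρ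
/-- item stmt-QuantumFields-26795 · crux · rank 3 · SPLIT (gen 1) into HelicityDualIdentity, HartmanWatsonMixture, CurrentSideDomination + glue WilsonDilutedVillainComparison_of_children · direct attempts still welcome (low priority) · by planner
why it might fail: Export ρ ≤ e^{−c₀β} needs the Hartman–Watson hot fraction η_β(t>1/(c₀β)) ≤ e^{−c₀β}: true iff c₀ < 2 (heavy-tail amplitude K₀/I₀ ≈ πe^{−2β}; Gaussian part rate 3(1/c₀−1)²/2); and c = 1 needs child 1 exact in the tree's plaquette conventions (single count, N = 1).
sources: arXiv:1904.00595, arXiv:1502.04796, arXiv:2110.09498, arXiv:hep-lat/0311007, MontvayMunster1994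
[crux, rank 3; RESTATED g6 to export the rate, and SPLIT into HelicityDualIdentity →
HartmanWatsonMixture → CurrentSideDomination (glue proved in the planner folder, c = 1)] Wilson ≥
diluted-Villain comparison with exported defect rate: there are c, c₀ > 0 and β₀ such that for every
β > β₀ some ρ ∈ [0, e^{−c₀β}] satisfies c·DILV(c₀β, ρ, M, N) ≤ β·⟨cos θ_p⟩_{Λ_{M+1},β}·#B_N −
β²·Var(Σ_{B_N} sin θ_(x;0,1)) for all 2N+2 ≤ M (torus Wilson U(1)₄ helicity modulus of the box
dominates the annealed-diluted Villain-dual flux variance at dual coupling c₀β). Mechanism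
(current-side conditioning): character duality (child 1) makes the right side E_dual[N_B²] under
weights ∏ I_{n_p}(β); Hartman–Watson (child 2) writes I_n(β) = ∫e^{−n²t/2}dΘ_β, so the Wilson dual
law is an annealed inhomogeneous Villain-dual law whose temperatures are conditionally independent
given the currents; lattice-Gaussian monotonicity + MLR + Bernoulli coupling (child 3) bound it
below by DILV at ρ = Hartman–Watson hot fraction ≤ e^{−c₀β}. -/
@[route_item "route-QuantumFields-WilsonVillainDualStiffness", crux]
def WilsonDilutedVillainComparison : Prop :=
  ∃ c : ℝ, 0 < c ∧ ∃ c₀ : ℝ, 0 < c₀ ∧ ∃ β₀ : ℝ, ∀ β : ℝ, β₀ < β → ∃ ρ : ℝ, 0 ≤ ρ ∧ ρ ≤ Real.exp (-(c₀ * β)) ∧ ∀ N M : ℕ, 2 * N + 2 ≤ M → c * ((fun (Λ ρ : ℝ) (M N : ℕ) => ∑ H : Finset (Literature.MathematicalPhysics.QuantumFieldTheory.Plaquette 4 (M + 1)), ρ ^ H.card * (1 - ρ) ^ (Fintype.card (Literature.MathematicalPhysics.QuantumFieldTheory.Plaquette 4 (M + 1)) - H.card) * ((∑' n : Literature.MathematicalPhysics.QuantumFieldTheory.Plaquette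 4 (M + 1) → ℤ, (if (∀ p ∈ H, n p = 0) ∧ (∀ e : Literature.MathematicalPhysics.QuantumFieldTheory.Edge 4 (M + 1), ∑ p : Literature.MathematicalPhysics.QuantumFieldTheory.Plaquette 4 (M + 1), n p * Literature.MathematicalPhysics.QuantumFieldTheory.LatticeForm.res (Literature.MathematicalPhysics.QuantumFieldTheory.LatticeForm.td₁ (fun (y : Literature.MathematicalPhysics.QuantumFieldTheory.Site 4 (M + 1)) (k : Fin 4) => if y = e.1 ∧ k = e.2 then (1 : ℤ) else 0)) p = 0) then Real.exp (-(∑ p : Literature.MathematicalPhysics.QuantumFieldTheory.Plaquette 4 (M + 1), ((n p : ℝ) ^ 2)) / (2 * Λ)) else 0) * (∑ x ∈ Literature.Probability.LatticeModels.box 4 N, (n ((fun i => ((x i : ℤ) : ZMod (M + 1))), ⟨((0 : Fin 4), (1 : Fin 4)), by decide⟩) : ℝ)) ^ 2) / (∑' n : Literature.MathematicalPhysics.QuantumFieldTheory.Plaquette 4 (M + 1) → ℤ, (if (∀ p ∈ H, n p = 0) ∧ (∀ e : Literature.MathematicalPhysics.QuantumFieldTheory.Edge 4 (M + 1), ∑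 p : Literature.MathematicalPhysics.QuantumFieldTheory.Plaquette 4 (M + 1), n p * Literature.MathematicalPhysics.QuantumFieldTheory.LatticeForm.res (Literature.MathematicalPhysics.QuantumFieldTheory.LatticeForm.td₁ (fun (y : Literature.MathematicalPhysics.QuantumFieldTheory.Site 4 (M + 1)) (k : Fin 4) => if y = e.1 ∧ k = e.2 then (1 : ℤ) else 0)) p = 0) then Real.exp (-(∑ p : Literature.MathematicalPhysics.QuantumFieldTheory.Plaquette 4 (M + 1), ((n p : ℝ) ^ 2)) / (2 * Λ)) else 0)))) (c₀ * β) ρ M N) ≤ β * Summit.QuantumFields.YangMills.Theorems.U1Helicity.torusMeanPlaq β M * ((Literature.Probability.LatticeModels.box 4 N).card : ℝ) - β * (β * Summit.QuantumFields.YangMills.Theorems.U1Helicity.torusBoxVar β M N)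

-- parent: WilsonDilutedVillainComparison · child (gen 1)
/--     item stmt-QuantumFields-26808 · crux · rank 301 · open
    parent: WilsonDilutedVillainComparison · by planner
    why it might fail: Convention-sensitive exactness: needs Plaquette 4 (M+1) to count each plaquette once and weight exp(−βΣ_p(1−cos θ_p)) (wilsonAction, N=1); a double count turns I_n(β) into I_n(2β), a sign mismatch res∘td₁ vs holonomy breaks co-closedness matching — decidable numerically on the 2⁴ torus.
    sources: arXiv:hep-lat/0311007, MontvayMunster1994, FrohlichSpencerCMP1982, Literature.MathematicalPhysics.QuantumFieldTheory.zdU1DualPartition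
[child 1 of WilsonDilutedVillainComparison, size M, exact] Torus helicity-modulus /
character-duality identity for Wilson U(1)₄ on (ℤ/(M+1))⁴: for β > 0 and 2N+2 ≤ M, β·⟨cos θ_p⟩·#B_N
− β²·Var(Σ_{x∈B_N} sin θ_(x;0,1)) = E_dual[N_B²], the second moment of the dual flux N_B = Σ_{x∈B_N}
n_(x;0,1) under the positive weight 1_{δn=0}·∏_p I_{n_p}(β) on integer plaquette fields (I_n(β) =
(1/π)∫₀^π e^{β cos θ} cos(nθ) dθ, inlined). Proof route: Z(α) = ∫∏_p e^{β cos(θ_p + α·1_B(p))};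
−(log Z)''(0) computed on the angle side (= LHS, Z'(0) = 0 by θ ↦ −θ) and on the character side
(e^{β cos φ} = Σ_n I_n(β)e^{inφ}, link integration forces Σ_p n_p (dδ_e)(p) = 0, i.e. the inlined
co-closedness; = Var_dual(N_B), mean 0 by n ↦ −n). -/
@[route_item "route-QuantumFields-WilsonVillainDualStiffness"]
def HelicityDualIdentity : Prop :=
  ∀ β : ℝ, 0 < β → ∀ N M : ℕ, 2 * N + 2 ≤ M → β * Summit.QuantumFields.YangMills.Theorems.U1Helicity.torusMeanPlaq β M * ((Literature.Probability.LatticeModels.box 4 N).card : ℝ) - β * (β * Summit.QuantumFields.YangMills.Theorems.U1Helicity.torusBoxVar β M N) = (fun (β : ℝ) (M N : ℕ) => (∑' n : Literature.MathematicalPhysics.QuantumFieldTheory.Plaquette 4 (M + 1) → ℤ, (if (∀ e : Literature.MathematicalPhysics.QuantumFieldTheory.Edge 4 (M + 1), ∑ p : Literature.MathematicalPhysics.QuantumFieldTheory.Plaquette 4 (M + 1), n p * Literature.MathematicalPhysics.QuantumFieldTheory.LatticeForm.res (Literature.MathematicalPhysics.QuantumFieldTheory.LatticeForm.td₁ (fun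 (y : Literature.MathematicalPhysics.QuantumFieldTheory.Site 4 (M + 1)) (k : Fin 4) => if y = e.1 ∧ k = e.2 then (1 : ℤ) else 0)) p = 0) then (∏ p : Literature.MathematicalPhysics.QuantumFieldTheory.Plaquette 4 (M + 1), ((∫ θ in (0:ℝ)..Real.pi, Real.exp (β * Real.cos θ) * Real.cos (((n p : ℤ) : ℝ) * θ)) / Real.pi)) * (∑ x ∈ Literature.Probability.LatticeModels.box 4 N, (n ((fun i => ((x i : ℤ) : ZMod (M + 1))), ⟨((0 : Fin 4), (1 : Fin 4)), by decide⟩) : ℝ)) ^ 2 else 0)) / (∑' n : Literature.MathematicalPhysics.QuantumFieldTheory.Plaquette 4 (M + 1) → ℤ, (if (∀ e : Literature.MathematicalPhysics.QuantumFieldTheory.Edge 4 (M + 1), ∑ p : Literature.MathematicalPhysics.QuantumFieldTheory.Plaquette 4 (M + 1), n p * Literature.MathematicalPhysics.QuantumFieldTheory.LatticeForm.res (Literature.MathematicalPhysics.QuantumFieldTheory.LatticeForm.td₁ (fun (y : Literature.MathematicalPhysics.QuantumFieldTheory.Site 4 (M + 1)) (k : Fin 4) => if y = e.1 ∧ k =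 e.2 then (1 : ℤ) else 0)) p = 0) then (∏ p : Literature.MathematicalPhysics.QuantumFieldTheory.Plaquette 4 (M + 1), ((∫ θ in (0:ℝ)..Real.pi, Real.exp (β * Real.cos θ) * Real.cos (((n p : ℤ) : ℝ) * θ)) / Real.pi)) else 0))) β M N

-- parent: WilsonDilutedVillainComparison · child (gen 1)
/--     item stmt-QuantumFields-26809 · crux · rank 302 · closed · proved by Summit.QuantumFields.YangMills.Theorems.hartmanWatsonMixture_proof (prover)
    parent: WilsonDilutedVillainComparison · by planner
    why it might fail: Mixture holds for all β>0 (HW 1974); the tail clause is the risk: hot fraction ≈ √(2πc₀β)e^{−2β} + e^{−3(1/c₀−1)²β/2}, so it needs c₀<2 — as typed (∃c₀) only a wrong heavy-tail amplitude kills it; falsifier: HW tail numerics β=20,80 (g5 addendum §2 consistent).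
    sources: HartmanWatson1974 (Ann. Probab. 2, 593–607), arXiv:1904.00595, BarrieuRouaultYor2004 (J. Appl. Probab. 41, 1049–1058), galaxy:panama:206355998703635 (Mansuy–Yor, Aspects of Brownian Motion), DLMF 10.32.3, 10.38.4
[crux, size L; shared by routes WilsonVillainDualStiffness (child 2 of
WilsonDilutedVillainComparison) and WilsonVillainPerimeterTransfer (r4)] Hartman–Watson mixture +
hot-set tail: for some c₀ > 0 and all β > β₀ there is a finite measure Θ on (0,∞) with ∫ e^{−k²t/2}
dΘ = (1/π)∫₀^π e^{β cos θ} cos(kθ) dθ = I_k(β) for every k ∈ ℤ — the Hartman–Watson law I₀(β)·η_β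
(Hartman–Watson 1974, Yor 1980); in the tree this is
`Literature.Probability.HartmanWatson1974.IsMixingMeasure β Θ` / the named fact `HartmanWatsonLaw`
(file VonMisesMixture.lean, not importable from this route file), the bridge from the inlined
integral to the series `besselI` being
`Literature.Analysis.FunctionSpaces.latticeModels_besselI_eq_besselI_natAbs` + evenness of cos — AND
the tail bound Θ{t > 1/(c₀β)} ≤ e^{−c₀β}·Θ(ℝ). CONSTANT (corrects the earlier gloss 'any c₀ < 2'):
g6 numerics (kit jobs j304086, j304165: Laplace inversion of λ ↦ (I₀(β) − I_{√(2λ)}(β))/λ, talbot =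
dehoog to ≥ 10 digits for β ≤ 160) give for ρ(β,c₀) := η_β{t > 1/(c₀β)} the rates −log ρ/β = 0.518,
0.478, 0.454, 0.439 at β = 20, 40, 80, 160 when c₀ = 1/2 — so the clause FAILS for c₀ = 1/2 from β ≈
25 on (ρ·e^{c₀β} = 2.4, 41, 1.7e4) — and 0.723, -/
@[route_item "route-QuantumFields-WilsonVillainDualStiffness"]
def HartmanWatsonMixture : Prop :=
  ∃ c₀ : ℝ, 0 < c₀ ∧ ∃ β₀ : ℝ, ∀ β : ℝ, β₀ < β → ∃ Θ : MeasureTheory.Measure ℝ, MeasureTheory.IsFiniteMeasure Θ ∧ Θ (Set.Iic 0) = 0 ∧ (∀ k : ℤ, ((∫ θ in (0:ℝ)..Real.pi, Real.exp (β * Real.cos θ) * Real.cos (((k : ℤ) : ℝ) * θ)) / Real.pi) = ∫ t, Real.exp (-(((k : ℝ) ^ 2) * t) / 2) ∂Θ) ∧ Θ {t : ℝ | 1 / (c₀ * β) < t} ≤ ENNReal.ofReal (Real.exp (-(c₀ * β))) * Θ Set.univ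

-- `HartmanWatsonMixture` holds: proved by `Summit.QuantumFields.YangMills.Theorems.hartmanWatsonMixture_proof` (its module imports this route file, so no `_holds` link can be stated here).

-- parent: WilsonDilutedVillainComparison · child (gen 1)
/--     item stmt-QuantumFields-26810 · crux · rank 303 · open
    parent: WilsonDilutedVillainComparison · by planner
    why it might fail: Needs RSD/AHPS second-moment monotonicity for CENTRED lattice Gaussians on the co-closed sublattice under (a) raising one diagonal coupling, (b) forcing n_p=0 — special cases of printed form/sublattice monotonicity; MLR⇒stochastic order; Strassen coupling. Risk = tsum/Fubini size, not truth.
    sources: arXiv:1502.04796 (Regev–Stephens-Davidowitz, §3–5), arXiv:2110.09498 (Aizenman–Harel–Peled–Shapiro, Props 2.1–2.2, Lemma 9.6), Strassen1965 (Ann. Math. Statist. 36, 423–439), arXiv:1904.00595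
[child 3, size M–L, load-bearing but known tools, constant 1] Current-side annealed-Villain
domination: for β > 0, c₀ > 0 and ANY finite positive Θ on (0,∞) with I_k(β) = ∫e^{−k²t/2}dΘ (all k
∈ ℤ), the Wilson-dual flux second moment E_dual[N_B²] is ≥ the annealed Bernoulli(ρ)-diluted
Villain-dual second moment at coupling Λ = c₀β (the route functional, inlined) with ρ = Θ(t >
1/(c₀β))/Θ(ℝ). Chain: joint law of (n,t) ∝ 1_{δn=0}∏_p e^{−n_p²t_p/2}Θ(dt_p) has n-marginal =
Wilson-dual; E[N_B²|t] is non-increasing in each t_p (Regev–Stephens-Davidowitz / AHPS second-moment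
monotonicity in the quadratic form on the co-closed lattice) and under forcing n_p = 0 (sublattice
monotonicity), so E[N_B²|t] ≥ V_{c₀β}(H(t)), H(t) = {p : t_p > 1/(c₀β)}; given n the t_p are
independent with laws ∝ e^{−n_p²t/2}Θ(dt), MLR-decreasing in n_p², so P(p hot | n) ≤ ρ and H(t)|n ≼
Bernoulli(ρ)^⊗P (Strassen); V antitone in H ⇒ E ≥ Σ_H ρ^|H|(1−ρ)^(#P−|H|) V_{c₀β}(H). -/
@[route_item "route-QuantumFields-WilsonVillainDualStiffness"]
def CurrentSideDomination : Prop :=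
  ∀ β : ℝ, 0 < β → ∀ c₀ : ℝ, 0 < c₀ → ∀ Θ : MeasureTheory.Measure ℝ, MeasureTheory.IsFiniteMeasure Θ → Θ (Set.Iic 0) = 0 → (∀ k : ℤ, ((∫ θ in (0:ℝ)..Real.pi, Real.exp (β * Real.cos θ) * Real.cos (((k : ℤ) : ℝ) * θ)) / Real.pi) = ∫ t, Real.exp (-(((k : ℝ) ^ 2) * t) / 2) ∂Θ) → ∀ N M : ℕ, 2 * N + 2 ≤ M → (fun (Λ ρ : ℝ) (M N : ℕ) => ∑ H : Finset (Literature.MathematicalPhysics.QuantumFieldTheory.Plaquette 4 (M + 1)), ρ ^ H.card * (1 - ρ) ^ (Fintype.card (Literature.MathematicalPhysics.QuantumFieldTheory.Plaquette 4 (M + 1)) - H.card) * ((∑' n : Literature.MathematicalPhysics.QuantumFieldTheory.Plaquette 4 (M + 1) → ℤ, (if (∀ p ∈ H, n p = 0) ∧ (∀ e : Literature.MathematicalPhysics.QuantumFieldTheory.Edge 4 (M + 1), ∑ p : Literature.MathematicalPhysics.QuantumFieldTheory.Plaquette 4 (M + 1), n p * Literature.MathematicalPhysics.QuantumFieldTheory.LatticeForm.res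 (Literature.MathematicalPhysics.QuantumFieldTheory.LatticeForm.td₁ (fun (y : Literature.MathematicalPhysics.QuantumFieldTheory.Site 4 (M + 1)) (k : Fin 4) => if y = e.1 ∧ k = e.2 then (1 : ℤ) else 0)) p = 0) then Real.exp (-(∑ p : Literature.MathematicalPhysics.QuantumFieldTheory.Plaquette 4 (M + 1), ((n p : ℝ) ^ 2)) / (2 * Λ)) else 0) * (∑ x ∈ Literature.Probability.LatticeModels.box 4 N, (n ((fun i => ((x i : ℤ) : ZMod (M + 1))), ⟨((0 : Fin 4), (1 : Fin 4)), by decide⟩) : ℝ)) ^ 2) / (∑' n : Literature.MathematicalPhysics.QuantumFieldTheory.Plaquette 4 (M + 1) → ℤ, (if (∀ p ∈ H, n p = 0) ∧ (∀ e : Literature.MathematicalPhysics.QuantumFieldTheory.Edge 4 (M + 1), ∑ p : Literature.MathematicalPhysics.QuantumFieldTheory.Plaquette 4 (M + 1), n p * Literature.MathematicalPhysics.QuantumFieldTheory.LatticeForm.res (Literature.MathematicalPhysics.QuantumFieldTheory.LatticeForm.td₁ (fun (y : Literature.MathematicalPhysics.QuantumFieldTheory.Site 4 (M + 1)) (k :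 Fin 4) => if y = e.1 ∧ k = e.2 then (1 : ℤ) else 0)) p = 0) then Real.exp (-(∑ p : Literature.MathematicalPhysics.QuantumFieldTheory.Plaquette 4 (M + 1), ((n p : ℝ) ^ 2)) / (2 * Λ)) else 0)))) (c₀ * β) ((Θ {t : ℝ | 1 / (c₀ * β) < t}).toReal / (Θ Set.univ).toReal) M N ≤ (fun (β : ℝ) (M N : ℕ) => (∑' n : Literature.MathematicalPhysics.QuantumFieldTheory.Plaquette 4 (M + 1) → ℤ, (if (∀ e : Literature.MathematicalPhysics.QuantumFieldTheory.Edge 4 (M + 1), ∑ p : Literature.MathematicalPhysics.QuantumFieldTheory.Plaquette 4 (M + 1), n p * Literature.MathematicalPhysics.QuantumFieldTheory.LatticeForm.res (Literature.MathematicalPhysics.QuantumFieldTheory.LatticeForm.td₁ (fun (y : Literature.MathematicalPhysics.QuantumFieldTheory.Site 4 (M + 1)) (k : Fin 4) => if y = e.1 ∧ k = e.2 then (1 : ℤ) else 0)) p = 0) then (∏ p : Literature.MathematicalPhysics.QuantumFieldTheory.Plaquette 4 (M + 1), ((∫ θ in (0:ℝ)..Real.pi, Real.exp (β * Real.cos θ)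 * Real.cos (((n p : ℤ) : ℝ) * θ)) / Real.pi)) * (∑ x ∈ Literature.Probability.LatticeModels.box 4 N, (n ((fun i => ((x i : ℤ) : ZMod (M + 1))), ⟨((0 : Fin 4), (1 : Fin 4)), by decide⟩) : ℝ)) ^ 2 else 0)) / (∑' n : Literature.MathematicalPhysics.QuantumFieldTheory.Plaquette 4 (M + 1) → ℤ, (if (∀ e : Literature.MathematicalPhysics.QuantumFieldTheory.Edge 4 (M + 1), ∑ p : Literature.MathematicalPhysics.QuantumFieldTheory.Plaquette 4 (M + 1), n p * Literature.MathematicalPhysics.QuantumFieldTheory.LatticeForm.res (Literature.MathematicalPhysics.QuantumFieldTheory.LatticeForm.td₁ (fun (y : Literature.MathematicalPhysics.QuantumFieldTheory.Site 4 (M + 1)) (k : Fin 4) => if y = e.1 ∧ k = e.2 then (1 : ℤ) else 0)) p = 0) then (∏ p : Literature.MathematicalPhysics.QuantumFieldTheory.Plaquette 4 (M + 1), ((∫ θ in (0:ℝ)..Real.pi, Real.exp (β * Real.cos θ) * Real.cos (((n p : ℤ) : ℝ) * θ)) / Real.pi)) else 0))) β M N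

-- parent: WilsonDilutedVillainComparison · glue (gen 1)
/--     item stmt-QuantumFields-26811 · support · rank 304 · closed · proved by Summit.QuantumFields.YangMills.Theorems.WilsonVillainDualStiffness.wilsonDilutedVillainComparison_of_children_proof (prover)
    parent: WilsonDilutedVillainComparison · GLUE: children ⟹ parent · by planner
HelicityDualIdentity → HartmanWatsonMixture → CurrentSideDomination →
WilsonDilutedVillainComparison, with c = 1 and ρ = the Hartman–Watson hot fraction Θ(t >
1/(c₀β))/Θ(ℝ) ≤ e^(−c₀β): PROVED in the planner folder (wvds6/ItemsGlue.lean, theorem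
wilsonDilutedVillainComparison_of_children, rc 0, 0 sorry — 25 lines of logic + ENNReal.toReal
arithmetic); a prover lands it verbatim. -/
@[route_item "route-QuantumFields-WilsonVillainDualStiffness"]
def WilsonDilutedVillainComparison_of_children : Prop :=
  HelicityDualIdentity → HartmanWatsonMixture → CurrentSideDomination → WilsonDilutedVillainComparison

-- `WilsonDilutedVillainComparison_of_children` holds: proved by `Summit.QuantumFields.YangMills.Theorems.WilsonVillainDualStiffness.wilsonDilutedVillainComparison_of_children_proof` (its module imports this route file, so no `_holds` link can be stated here).

/-! D-0027 §2.1 — DECIDING THEOREM (planner-authored via `route open/edit --closes-file`; by planner-ym-idea-3-g6-0 2026-08-28T07:58:49Z):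
its hypotheses are this route's items and its conclusion the sub-problem Statement (glue_lint), and it elaborates with this file. -/

@[closes "route-QuantumFields-WilsonVillainDualStiffness"] theorem closes (h₁ : Summit.QuantumFields.YangMills.Theses.WilsonVillainDualStiffness.DilutedVillainDualStiffness) (h₂ : Summit.QuantumFields.YangMills.Theses.WilsonVillainDualStiffness.WilsonDilutedVillainComparison) :
    Summit.QuantumFields.YangMills.Theorems.U1HelicityGapTorusD4 := by
  obtain ⟨Λ₁, hT2⟩ := h₁
  obtain ⟨c, hc, c₀, hc₀, β₀, hβ₀⟩ := h₂
  refine ⟨max β₀ (max (Λ₁ / c₀) 1), fun β hβ => ?_⟩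
  have hβ0 : β₀ < β := lt_of_le_of_lt (le_max_left _ _) hβ
  have hβ1 : Λ₁ / c₀ < β := lt_of_le_of_lt ((le_max_left _ _).trans (le_max_right _ _)) hβ
  have hβpos : 0 < β := lt_of_lt_of_le one_pos (le_of_lt (lt_of_le_of_lt ((le_max_right _ _).trans (le_max_right _ _)) hβ))
  have hΛ : Λ₁ < c₀ * β := by
    rw [div_lt_iff₀ hc₀] at hβ1; linarith [mul_comm β c₀]
  obtain ⟨ρ, hρ0, hρ1, hcmp⟩ := hβ₀ β hβ0
  obtain ⟨δ, hδ, N₀, hN⟩ := hT2 (c₀ * β) hΛ ρ hρ0 hρ1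
  refine ⟨c * δ * c₀, by positivity, N₀, fun N hN₀ => ?_⟩
  obtain ⟨M₀, hM⟩ := hN N hN₀
  refine ⟨max M₀ (2 * N + 2), fun M hM₀ => ?_⟩
  have h2 := hM M ((le_max_left _ _).trans hM₀)
  have h1 := hcmp N M ((le_max_right _ _).trans hM₀)
  have hB : (0 : ℝ) ≤ ((Literature.Probability.LatticeModels.box 4 N).card : ℝ) := by positivity
  have key : β * (β * Summit.QuantumFields.YangMills.Theorems.U1Helicity.torusBoxVar β M N) ≤
      β * ((Summit.QuantumFields.YangMills.Theorems.U1Helicity.torusMeanPlaq β M - c * δ * c₀) *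
        ((Literature.Probability.LatticeModels.box 4 N).card : ℝ)) := by
    nlinarith [mul_le_mul_of_nonneg_left h2 hc.le]
  exact le_of_mul_le_mul_left key hβpos

end Summit.QuantumFields.YangMills.Theses.WilsonVillainDualStiffness
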